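import Summits.QuantumFields.YangMills.Theses.ComplexCouplingChannel
import Summits.QuantumFields.YangMills.Theorems.ComplexCouplingChannelFreeEnergyWindowChannelStubLocalRePart
import Literature.MathematicalPhysics.QuantumFieldTheory.WilsonFinTorusPartitionComplex
import Literature.Analysis.Complex.CauchyTaylorBall
import Mathlib.Analysis.Complex.BorelCaratheodory
import Mathlib.Analysis.Complex.RealDeriv
import HarnessLib

/-!
# `ComplexCouplingChannel.FreeEnergyWindowChannel` — line Sketch, stub `stub_cumulantRadius_of_crux`

Stub Y2 (layer 6: crux ⇒ CUMULANT RADIUS) of line `Sketch` for crux `FreeEnergyWindowChannel`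
(item `stmt-QuantumFields-18842`, route `ComplexCouplingChannel` of `QuantumFields/YangMills`).

Under the crux, for every admissible `(G, r)` there is `β₁` such that at every real `t ≥ β₁` the derivatives of
the finite-volume free energies `s ↦ log Z_ℝ(s; P⁴)`, `Z_ℝ(s; P⁴) = wilsonFinTorusPartition r.ρ s P P P P`, grow at
most geometrically at `t`, `|∂ⁿ log Z_ℝ(·; P⁴) (t)| ≤ K_P · n! · Cⁿ` for `n ≥ 1` and `P ≥ P₀`, with the RADIUS
CONSTANT `C` UNIFORM IN THE VOLUME `P` (the prefactor `K_P` may depend on `P`).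

Proof.  The crux's window at `(t, ρ := 1)` gives an open `D ∋ t` and `P₀` with `Z_P z ≠ 0` for `z ∈ D`, `P ≥ P₀`,
where `Z_P z = wilsonFinTorusPartitionC r.ρ z P P P P` is ENTIRE (`differentiable_wilsonFinTorusPartitionC`).  Fix a
disc `ball t R ⊆ D` and put `C := 4 / R`.  For `P ≥ P₀`:
* LOCAL REAL PART (landed `exists_differentiableOn_re_eq_log_norm`): `log ‖Z_P‖ = Re g` on `ball t R` for a
  holomorphic `g`;
* `Re g = log ‖Z_P‖ ≤ ‖Z_P‖ ≤ B_P` on the disc (`Z_P` is continuous on the compact `closedBall t R`);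
* BOREL–CARATHÉODORY (Mathlib `Complex.borelCaratheodory`, shifted to the centre `t`): `‖g‖ ≤ 2 M' + 3 ‖g t‖` on
  `ball t (R/2)`, `M' = max B_P 1`;
* CAUCHY'S ESTIMATE on `ball t (R/2)` (`Literature.Analysis.Complex.norm_iteratedDeriv_le_of_forall_mem_ball`):
  `‖g⁽ⁿ⁾(t)‖ ≤ n! (2 M' + 3 ‖g t‖) / (R/4)ⁿ`;
* REAL SIDE: at a real coupling the complex partition function is the positive real one
  (`wilsonFinTorusPartitionC_ofReal`, `wilsonFinTorusPartition_pos`), so `log Z_ℝ(s; P⁴) = Re g s` for real `s` near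
  `t`, and the `n`-th derivative along the reals of `s ↦ Re g s` is `Re g⁽ⁿ⁾` (`iteratedDeriv_re_comp_ofReal`,
  induction with `HasDerivAt.real_of_complex`); finally `|Re w| ≤ ‖w‖`.
Only the ZERO-FREENESS clause of the window is used (the bound `|log ‖Z_P‖ + P⁴ Re f| ≤ M` would make `K_P` grow like
`P⁴`, which the statement does not record).

Nothing here asserts a Theses statement; the file proves `crux → consequence` and supports the crux item.
-/

set_option autoImplicit false

noncomputable section

open Filter Topology Metric Set Complex
open Literature.MathematicalPhysics.QuantumFieldTheory

namespace Summit.QuantumFields.YangMills.Theorems.FreeEnergyWindowChannel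

/-- **Borel–Carathéodory on a disc centred at `c`, inner half.**  If `g` is holomorphic on `ball c R` with
`Re g ≤ M` there (`0 < M`), then `‖g z‖ ≤ 2 M + 3 ‖g c‖` for `z ∈ ball c (R / 2)` (Mathlib's
`Complex.borelCaratheodory` for `w ↦ g (c + w)`: `‖g z‖ ≤ 2M‖w‖/(R - ‖w‖) + ‖g c‖ (R + ‖w‖)/(R - ‖w‖)`, `w = z - c`,
and `‖w‖ < R/2`). [folklore] -/
theorem norm_le_of_re_le_of_mem_ball_half {g : ℂ → ℂ} {c : ℂ} {R M : ℝ} (hR : 0 < R) (hM : 0 < M)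
    (hg : DifferentiableOn ℂ g (ball c R)) (hre : ∀ z ∈ ball c R, (g z).re ≤ M)
    {z : ℂ} (hz : z ∈ ball c (R / 2)) : ‖g z‖ ≤ 2 * M + 3 * ‖g c‖ := by
  -- shift the disc to the origin
  set F : ℂ → ℂ := fun w => g (c + w) with hF
  have hmaps : MapsTo (fun w : ℂ => c + w) (ball 0 R) (ball c R) := by
    intro w hw
    rw [mem_ball_zero_iff] at hw
    rwa [mem_ball, dist_eq_norm, add_sub_cancel_left]
  have hFd : DifferentiableOn ℂ F (ball 0 R) :=
    hg.comp ((differentiableOn_const c).add differentiableOn_id) hmaps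
  have hF₁ : MapsTo F (ball 0 R) {w | w.re ≤ M} := fun w hw => hre _ (hmaps hw)
  have hzc : ‖z - c‖ < R / 2 := by rwa [← dist_eq_norm, ← mem_ball]
  have hw : z - c ∈ ball (0 : ℂ) R := by
    rw [mem_ball_zero_iff]
    linarith
  have hBC := Complex.borelCaratheodory hM hFd hF₁ hR hw
  have hFz : F (z - c) = g z := by simp [hF]
  have hF0 : F 0 = g c := by simp [hF]
  rw [hFz, hF0] at hBC
  have hden : 0 < R - ‖z - c‖ := by linarith [norm_nonneg (z - c)]
  have h1 : 2 * M * ‖z - c‖ / (R - ‖z - c‖) ≤ 2 * M := by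
    rw [div_le_iff₀ hden]
    have : 0 < M * (R - 2 * ‖z - c‖) := mul_pos hM (by linarith)
    nlinarith
  have h2 : ‖g c‖ * (R + ‖z - c‖) / (R - ‖z - c‖) ≤ 3 * ‖g c‖ := by
    rw [div_le_iff₀ hden]
    have : 0 ≤ ‖g c‖ * (2 * R - 4 * ‖z - c‖) := mul_nonneg (norm_nonneg _) (by linarith)
    nlinarith
  linarith

/-- **Derivatives at the centre from an upper bound on the real part** (Borel–Carathéodory + Cauchy's estimate on
`ball c (R/2)`): if `g` is holomorphic on `ball c R` with `Re g ≤ M` there (`0 < M`), then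
`‖g⁽ⁿ⁾(c)‖ ≤ n! (2 M + 3 ‖g c‖) / (R/4)ⁿ`. [folklore] -/
theorem norm_iteratedDeriv_le_of_re_le {g : ℂ → ℂ} {c : ℂ} {R M : ℝ} (hR : 0 < R) (hM : 0 < M)
    (hg : DifferentiableOn ℂ g (ball c R)) (hre : ∀ z ∈ ball c R, (g z).re ≤ M) (n : ℕ) :
    ‖iteratedDeriv n g c‖ ≤ n.factorial * (2 * M + 3 * ‖g c‖) / (R / 4) ^ n := by
  have hR2 : 0 < R / 2 := half_pos hR
  have h := Literature.Analysis.Complex.norm_iteratedDeriv_le_of_forall_mem_ball hR2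
    (hg.mono (ball_subset_ball (half_le_self hR.le)))
    (fun z hz => norm_le_of_re_le_of_mem_ball_half hR hM hg hre hz) n
  have h4 : R / 2 / 2 = R / 4 := by ring
  rwa [h4] at h

/-- **Iterated derivatives along the reals of the real part of a holomorphic function.**  If `f` is holomorphic on
an open `U ⊆ ℂ`, then at every real `s` with `↑s ∈ U` the `n`-th derivative of `x ↦ Re f ↑x` (`x : ℝ`) is the real
part of the `n`-th complex derivative of `f` at `↑s`.  Induction on `n` (`HasDerivAt.real_of_complex`, the first
derivatives agreeing on the open set `(↑)⁻¹' U`; same pattern as the landed `iteratedDeriv_comp_ofReal`). [folklore] -/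
theorem iteratedDeriv_re_comp_ofReal {U : Set ℂ} (hU : IsOpen U) (n : ℕ) :
    ∀ {f : ℂ → ℂ}, DifferentiableOn ℂ f U → ∀ {s : ℝ}, (s : ℂ) ∈ U →
      iteratedDeriv n (fun x : ℝ => (f x).re) s = (iteratedDeriv n f s).re := by
  induction n with
  | zero => intro f _ s _; simp
  | succ n ih =>
    intro f hf s hs
    rw [iteratedDeriv_succ', iteratedDeriv_succ', ← ih (hf.deriv hU) hs]
    refine Filter.EventuallyEq.iteratedDeriv_eq n ?_
    filter_upwards [continuous_ofReal.continuousAt.preimage_mem_nhds (hU.mem_nhds hs)] with x hx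
    exact (hf.differentiableAt (hU.mem_nhds hx)).hasDerivAt.real_of_complex.deriv

/-- STUB Y2 of line `Sketch` (layer 6).  **crux ⇒ CUMULANT RADIUS**: under `FreeEnergyWindowChannel`, for every
admissible `(G, r)`, beyond `β₁`, at every real `t ≥ β₁` the derivatives of the finite-volume free energies
`s ↦ log Z_ℝ(s; P⁴)` at `t` grow at most geometrically, `|∂ⁿ log Z_ℝ(·; P⁴) (t)| ≤ K_P n! Cⁿ` (`n ≥ 1`, `P ≥ P₀`),
with `C = 4/R` UNIFORM in `P` for a disc `ball t R` inside the crux's zero-free channel at `(t, 1)`: `log ‖Z_P‖` is the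
real part of a holomorphic `g` on the disc, `Re g ≤ max B_P 1` there, Borel–Carathéodory and Cauchy bound
`‖g⁽ⁿ⁾(t)‖ ≤ n! (2 max B_P 1 + 3 ‖g t‖) (4/R)ⁿ`, and `∂ⁿ log Z_ℝ(·; P⁴)(t) = Re g⁽ⁿ⁾(t)`. [folklore] -/
theorem stub_cumulantRadius_of_crux :
    Summit.QuantumFields.YangMills.Theses.ComplexCouplingChannel.FreeEnergyWindowChannel →
    ∀ (G : Type) [Group G] [TopologicalSpace G] [IsTopologicalGroup G] [CompactSpace G] [MeasurableSpace G] [BorelSpace G], Literature.MathematicalPhysics.QuantumFieldTheory.IsCompactSimpleLieGroup G → ∀ r : Literature.MathematicalPhysics.QuantumFieldTheory.LatticeRep G,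
    ∃ β₁ : ℝ, ∀ t : ℝ, β₁ ≤ t → ∃ C : ℝ, 0 < C ∧ ∃ P₀ : ℕ, ∀ P : ℕ, P₀ ≤ P → ∃ K : ℝ, ∀ n : ℕ, 1 ≤ n →
      |iteratedDeriv n (fun s : ℝ =>
          Real.log (Literature.MathematicalPhysics.QuantumFieldTheory.wilsonFinTorusPartition r.ρ s P P P P)) t| ≤
        K * n.factorial * C ^ n := by
  intro h G _ _ _ _ _ _ hG r
  haveI : SecondCountableTopology G :=
    (r.continuous.isClosedEmbedding r.injective).isEmbedding.secondCountableTopology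
  obtain ⟨β₁, hβ₁⟩ := h G hG r
  refine ⟨β₁, fun t ht => ?_⟩
  -- the crux's zero-free window at `(t, 1)`
  obtain ⟨D, hDo, -, htD, -, f, -, M, P₀, hwin⟩ := hβ₁ t ht 1 one_pos
  have hwin' : ∀ P : ℕ, P₀ ≤ P → ∀ z ∈ D, wilsonFinTorusPartitionC r.ρ z P P P P ≠ 0 :=
    fun P hP z hz => (hwin P hP z hz).1
  -- a disc around `t` inside the channel; the radius constant `C = 4 / R` is uniform in `P`
  obtain ⟨R, hR, hRD⟩ := Metric.isOpen_iff.1 hDo (t : ℂ) htD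
  refine ⟨4 / R, by positivity, P₀, fun P hP => ?_⟩
  -- the entire partition function of the torus `P⁴`, zero-free on the disc
  set Z : ℂ → ℂ := fun z => wilsonFinTorusPartitionC r.ρ z P P P P with hZ
  have hZd : Differentiable ℂ Z := differentiable_wilsonFinTorusPartitionC r.ρ r.continuous P P P P
  have hZ0 : ∀ z ∈ ball (t : ℂ) R, Z z ≠ 0 := fun z hz => hwin' P hP z (hRD hz)
  -- `log ‖Z‖ = Re g` on the disc, `g` holomorphic
  obtain ⟨g, hgd, hg⟩ := exists_differentiableOn_re_eq_log_norm (c := (t : ℂ)) hR hZd.differentiableOn hZ0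
  -- `Re g = log ‖Z‖ ≤ ‖Z‖ ≤ B` on the disc (`Z` continuous on the compact closed disc)
  obtain ⟨B, hB⟩ :=
    (isCompact_closedBall (t : ℂ) R).exists_bound_of_continuousOn hZd.continuous.continuousOn
  set M' : ℝ := max B 1 with hM'
  have hM'0 : 0 < M' := lt_of_lt_of_le one_pos (le_max_right _ _)
  have hre : ∀ z ∈ ball (t : ℂ) R, (g z).re ≤ M' := fun z hz => by
    rw [hg z hz]
    exact ((Real.log_le_self (norm_nonneg _)).trans (hB z (ball_subset_closedBall hz))).trans (le_max_left _ _)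
  -- Borel–Carathéodory + Cauchy at the centre `t`
  set K : ℝ := 2 * M' + 3 * ‖g t‖ with hK
  refine ⟨K, fun n _ => ?_⟩
  have hder : ‖iteratedDeriv n g t‖ ≤ n.factorial * K / (R / 4) ^ n :=
    norm_iteratedDeriv_le_of_re_le hR hM'0 hgd hre n
  -- the real side: at real couplings near `t` the free energy is `Re g`
  have hU : IsOpen (ball (t : ℂ) R) := isOpen_ball
  have htU : ((t : ℝ) : ℂ) ∈ ball (t : ℂ) R := mem_ball_self hR
  have hnorm : ∀ s : ℝ, ‖Z (s : ℂ)‖ = wilsonFinTorusPartition r.ρ s P P P P := fun s => by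
    simp only [hZ, wilsonFinTorusPartitionC_ofReal, Complex.norm_real, Real.norm_eq_abs]
    exact abs_of_pos (wilsonFinTorusPartition_pos r.continuous s P P P P)
  have hEq : (fun s : ℝ => Real.log (wilsonFinTorusPartition r.ρ s P P P P)) =ᶠ[𝓝 t]
      fun s : ℝ => (g s).re := by
    filter_upwards [continuous_ofReal.continuousAt.preimage_mem_nhds (hU.mem_nhds htU)] with s hs
    rw [hg _ hs, hnorm s]
  rw [hEq.iteratedDeriv_eq n, iteratedDeriv_re_comp_ofReal hU n hgd htU]
  calc |(iteratedDeriv n g t).re| ≤ ‖iteratedDeriv n g t‖ := Complex.abs_re_le_norm _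
    _ ≤ n.factorial * K / (R / 4) ^ n := hder
    _ = K * n.factorial * (4 / R) ^ n := by
        rw [show (4 / R) ^ n = ((R / 4) ^ n)⁻¹ by rw [← inv_pow, inv_div]]
        ring

end Summit.QuantumFields.YangMills.Theorems.FreeEnergyWindowChannel

end
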